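import Mathlib
import Summits.Ventures.HodgeRepro2.T5PrincipalUnitFiltration
import Summits.Ventures.HodgeRepro2.T5PrincipalUnitComparison
import Summits.Ventures.HodgeRepro2.T5RamifiedCharacterInflation

/-!
# The twist `β_t(1 + x) := β(1 + t⁻¹ x)` of a character of a higher unit group
  (the algebraic core of Lemma N5.L6(2) of `route/TIER5.md` §N5.12.2)

Lemma N5.L6(2) («at a ramified place both signs occur in every large even conductor») takes a
conjugate-orthogonal character `β` of conductor exactly `2k`, a base unit `t ∈ U_{F_v}` with
`η_v(t) = −1`, and forms `β_t(1 + x) := β(1 + t⁻¹ x)` on `U_E^k`. The prose proves, by hand,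
that `β_t` is a character of `U_E^k / U_E^{2k}`, trivial on `U_E^k ∩ F_v^×`, non-trivial on
`U_E^{2k−1}`, and extends (A8b) to a conjugate-orthogonal character of `E_v^×` of conductor
exactly `2k`; the sign flip `ε(ω̃ β_t) = −ε(ω̃ β)` is then the ε-factor input [FM21-Cor-2.3].
This file kernel-checks the algebra:

* `twistFun`: `y ↦ 1 + t⁻¹ (y − 1)` is a self-map of `U_k = higherUnits ϖ k` (`S` local,
  `ϖ` in the maximal ideal, `k ≥ 1`), an involution up to `t ↦ t⁻¹`
  (`twistFun_twistFun`), preserving every level `U_n` (`twistFun_mem_iff`);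
* `twistFun_mul_mem`: `twistFun (y₁ y₂) ≡ twistFun y₁ · twistFun y₂ (mod U_{2k})` — the
  prose identity «numerator − denominator = t⁻¹ x₁ x₂ (1 − t⁻¹) ∈ P_E^{2k}»;
* `twist`: for `β : U_k →* ℂˣ` trivial on `U_{2k}`, `β ∘ twistFun` is a HOMOMORPHISM, trivial
  on `U_{2k}` (`twist_eq_one_of_mem`), trivial on the base units whenever `β` is and `t` is a
  base unit (`twist_eq_one_of_mem_range`, the base map being local), non-trivial on `U_n`
  whenever `β` is (`exists_twist_ne_one`);
* `exists_twisted_character`: the N5.L6(2) package at the level of `Sˣ` — a character `β` of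
  `Sˣ` trivial on `U_{2k}` and on the base units and non-trivial on `U_n` yields, for every base
  unit `t`, a character `β'` of `Sˣ` with the same three properties and
  `β' y = β (1 + t⁻¹ (y − 1))` on `U_k` (gluing lemma of `T5RamifiedCharacterInflation`).

What is NOT here: the ε-factor identity (the prose's [FM21-Cor-2.3] / [GGP-Prop-9] inputs),
the parameter `c_β`, and the local fields (everything is over an abstract local ring `S` with a
local algebra map `R → S`). Declaration per README §8(d): «uses an L-value-free non-vanishing
device: NO».
-/

namespace Summit.Ventures.HodgeRepro2.T5TwistedCharacter

open T5PrincipalUnitFiltration T5PrincipalUnitComparison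

section Twist

variable {S : Type*} [CommRing S] [IsLocalRing S] {ϖ : S} {k : ℕ}

/-- `1 + t⁻¹ (y − 1)` is a unit for `y ∈ U_k` (`k ≥ 1`, `ϖ` in the maximal ideal). -/
theorem isUnit_one_add_inv_mul_sub (hϖ : ϖ ∈ IsLocalRing.maximalIdeal S) (hk : 1 ≤ k) (t : Sˣ)
    {y : Sˣ} (hy : y ∈ higherUnits ϖ k) :
    IsUnit (1 + ((t⁻¹ : Sˣ) : S) * ((y : S) - 1)) := by
  rw [mem_higherUnits] at hy
  obtain ⟨c, hc⟩ := hy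
  have hmem : ((t⁻¹ : Sˣ) : S) * ((y : S) - 1) ∈ IsLocalRing.maximalIdeal S := by
    rw [hc]
    exact Ideal.mul_mem_left _ _ (Ideal.mul_mem_right _ _ (Ideal.pow_mem_of_mem _ hϖ _ hk))
  rcases IsLocalRing.isUnit_or_isUnit_one_sub_self (-(((t⁻¹ : Sˣ) : S) * ((y : S) - 1)))
    with h | h
  · exact absurd ((IsUnit.neg_iff _).1 h)
      (mem_nonunits_iff.1 ((IsLocalRing.mem_maximalIdeal _).1 hmem))
  · simpa [sub_neg_eq_add] using h

/-- The twist map `y ↦ 1 + t⁻¹ (y − 1)` on `U_k`. -/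
noncomputable def twistFun (hϖ : ϖ ∈ IsLocalRing.maximalIdeal S) (hk : 1 ≤ k) (t : Sˣ)
    (y : higherUnits ϖ k) : higherUnits ϖ k :=
  ⟨(isUnit_one_add_inv_mul_sub hϖ hk t y.2).unit, by
    rw [mem_higherUnits, IsUnit.unit_spec, add_sub_cancel_left]
    exact Dvd.dvd.mul_left ((mem_higherUnits ϖ k).1 y.2) _⟩

/-- The underlying element of the twist. -/
theorem coe_twistFun (hϖ : ϖ ∈ IsLocalRing.maximalIdeal S) (hk : 1 ≤ k) (t : Sˣ)
    (y : higherUnits ϖ k) :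
    (((twistFun hϖ hk t y : higherUnits ϖ k) : Sˣ) : S) =
      1 + ((t⁻¹ : Sˣ) : S) * (((y : Sˣ) : S) - 1) :=
  IsUnit.unit_spec _

/-- Twisting by `t⁻¹` undoes twisting by `t`. -/
theorem twistFun_twistFun (hϖ : ϖ ∈ IsLocalRing.maximalIdeal S) (hk : 1 ≤ k) (t : Sˣ)
    (y : higherUnits ϖ k) : twistFun hϖ hk t⁻¹ (twistFun hϖ hk t y) = y := by
  apply Subtype.ext
  apply Units.ext
  rw [coe_twistFun, coe_twistFun, inv_inv, add_sub_cancel_left, ← mul_assoc, Units.mul_inv,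
    one_mul, add_sub_cancel]

/-- The twist preserves every level of the filtration: `twistFun t y ∈ U_n ⟺ y ∈ U_n`. -/
theorem twistFun_mem_iff (hϖ : ϖ ∈ IsLocalRing.maximalIdeal S) (hk : 1 ≤ k) (t : Sˣ)
    (y : higherUnits ϖ k) (n : ℕ) :
    ((twistFun hϖ hk t y : higherUnits ϖ k) : Sˣ) ∈ higherUnits ϖ n ↔
      (y : Sˣ) ∈ higherUnits ϖ n := by
  rw [mem_higherUnits, mem_higherUnits, coe_twistFun, add_sub_cancel_left, Units.dvd_mul_left]

/-- The prose identity of Lemma N5.L6(2): `twistFun (y₁ y₂)` and `twistFun y₁ · twistFun y₂`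
differ by an element of `U_{2k}` — their difference is `t⁻¹ (1 − t⁻¹) (y₁ − 1)(y₂ − 1)`. -/
theorem twistFun_mul_mem (hϖ : ϖ ∈ IsLocalRing.maximalIdeal S) (hk : 1 ≤ k) (t : Sˣ)
    (y₁ y₂ : higherUnits ϖ k) :
    ((twistFun hϖ hk t (y₁ * y₂) * (twistFun hϖ hk t y₁ * twistFun hϖ hk t y₂)⁻¹ :
      higherUnits ϖ k) : Sˣ) ∈ higherUnits ϖ (2 * k) := by
  rw [mem_higherUnits]
  have e : (((twistFun hϖ hk t (y₁ * y₂) * (twistFun hϖ hk t y₁ * twistFun hϖ hk t y₂)⁻¹ :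
      higherUnits ϖ k) : Sˣ) : S) - 1 =
      (((twistFun hϖ hk t (y₁ * y₂) : Sˣ) : S) -
        ((twistFun hϖ hk t y₁ * twistFun hϖ hk t y₂ : higherUnits ϖ k) : Sˣ)) *
        ((((twistFun hϖ hk t y₁ * twistFun hϖ hk t y₂ : higherUnits ϖ k) : Sˣ)⁻¹ : Sˣ) : S) := by
    rw [Subgroup.coe_mul, Subgroup.coe_inv, Units.val_mul, sub_mul, Units.mul_inv]
  have e2 : ((twistFun hϖ hk t (y₁ * y₂) : Sˣ) : S) -
      ((twistFun hϖ hk t y₁ * twistFun hϖ hk t y₂ : higherUnits ϖ k) : Sˣ) =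
      ((t⁻¹ : Sˣ) : S) * (1 - ((t⁻¹ : Sˣ) : S)) *
        ((((y₁ : Sˣ) : S) - 1) * (((y₂ : Sˣ) : S) - 1)) := by
    simp only [Subgroup.coe_mul, Units.val_mul, coe_twistFun]
    ring
  rw [e, e2]
  refine Dvd.dvd.mul_right (Dvd.dvd.mul_left ?_ _) _
  rw [two_mul, pow_add]
  exact mul_dvd_mul ((mem_higherUnits ϖ k).1 y₁.2) ((mem_higherUnits ϖ k).1 y₂.2)

omit [IsLocalRing S] in
/-- A homomorphism trivial on the elements of `U_{2k}` takes equal values on elements of `U_k`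
that are congruent modulo `U_{2k}`. -/
theorem eq_of_mul_inv_mem {M : Type*} [Monoid M] (β : higherUnits ϖ k →* M)
    (hβ : ∀ y : higherUnits ϖ k, (y : Sˣ) ∈ higherUnits ϖ (2 * k) → β y = 1)
    {a b : higherUnits ϖ k} (h : ((a * b⁻¹ : higherUnits ϖ k) : Sˣ) ∈ higherUnits ϖ (2 * k)) :
    β a = β b := by
  have e : a = a * b⁻¹ * b := by group
  rw [e, map_mul, hβ _ h, one_mul]

/-- THE TWIST `β_t := β ∘ twistFun t` of a character `β` of `U_k` trivial on `U_{2k}`; it is a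
homomorphism by `twistFun_mul_mem`. -/
noncomputable def twist (hϖ : ϖ ∈ IsLocalRing.maximalIdeal S) (hk : 1 ≤ k)
    (β : higherUnits ϖ k →* ℂˣ)
    (hβ : ∀ y : higherUnits ϖ k, (y : Sˣ) ∈ higherUnits ϖ (2 * k) → β y = 1) (t : Sˣ) :
    higherUnits ϖ k →* ℂˣ :=
  MonoidHom.mk' (fun y => β (twistFun hϖ hk t y)) (fun y₁ y₂ => by
    rw [← map_mul]
    exact eq_of_mul_inv_mem β hβ (twistFun_mul_mem hϖ hk t y₁ y₂))

/-- `β_t(y) = β(1 + t⁻¹ (y − 1))`. -/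
theorem twist_apply (hϖ : ϖ ∈ IsLocalRing.maximalIdeal S) (hk : 1 ≤ k)
    (β : higherUnits ϖ k →* ℂˣ)
    (hβ : ∀ y : higherUnits ϖ k, (y : Sˣ) ∈ higherUnits ϖ (2 * k) → β y = 1) (t : Sˣ)
    (y : higherUnits ϖ k) : twist hϖ hk β hβ t y = β (twistFun hϖ hk t y) :=
  rfl

/-- `β_t` is trivial on `U_{2k}` (the twist preserves the level). -/
theorem twist_eq_one_of_mem (hϖ : ϖ ∈ IsLocalRing.maximalIdeal S) (hk : 1 ≤ k)
    (β : higherUnits ϖ k →* ℂˣ)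
    (hβ : ∀ y : higherUnits ϖ k, (y : Sˣ) ∈ higherUnits ϖ (2 * k) → β y = 1) (t : Sˣ)
    (y : higherUnits ϖ k) (hy : (y : Sˣ) ∈ higherUnits ϖ (2 * k)) :
    twist hϖ hk β hβ t y = 1 :=
  hβ _ ((twistFun_mem_iff hϖ hk t y _).2 hy)

/-- `β_t` is non-trivial on `U_n` whenever `β` is (witness: the twist of the witness by `t⁻¹`). -/
theorem exists_twist_ne_one (hϖ : ϖ ∈ IsLocalRing.maximalIdeal S) (hk : 1 ≤ k)
    (β : higherUnits ϖ k →* ℂˣ)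
    (hβ : ∀ y : higherUnits ϖ k, (y : Sˣ) ∈ higherUnits ϖ (2 * k) → β y = 1) (t : Sˣ) (n : ℕ)
    (h : ∃ y : higherUnits ϖ k, (y : Sˣ) ∈ higherUnits ϖ n ∧ β y ≠ 1) :
    ∃ y : higherUnits ϖ k, (y : Sˣ) ∈ higherUnits ϖ n ∧ twist hϖ hk β hβ t y ≠ 1 := by
  obtain ⟨y, hy, hy'⟩ := h
  refine ⟨twistFun hϖ hk t⁻¹ y, (twistFun_mem_iff hϖ hk t⁻¹ y n).2 hy, ?_⟩
  have h := twistFun_twistFun hϖ hk t⁻¹ y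
  rw [inv_inv] at h
  rw [twist_apply, h]
  exact hy'

end Twist

section Base

variable {R S : Type*} [CommRing R] [CommRing S] [Algebra R S] [IsLocalRing S]
  [IsLocalHom (algebraMap R S)] {ϖ : S} {k : ℕ}

/-- If `t` and `y` come from the base (`t = unitsMap t₀`, `y = unitsMap r`), so does the twist
`1 + t⁻¹ (y − 1) = unitsMap (1 + t₀⁻¹ (r − 1))` (the base map being local, the preimage of a
unit is a unit). -/
theorem exists_twistFun_eq_unitsMap (hϖ : ϖ ∈ IsLocalRing.maximalIdeal S) (hk : 1 ≤ k)
    (t₀ : Rˣ) (y : higherUnits ϖ k) (r : Rˣ) (hy : (y : Sˣ) = unitsMap r) :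
    ∃ r' : Rˣ, ((twistFun hϖ hk (unitsMap t₀) y : higherUnits ϖ k) : Sˣ) = unitsMap r' := by
  have hmap : algebraMap R S (1 + ((t₀⁻¹ : Rˣ) : R) * ((r : R) - 1)) =
      (((twistFun hϖ hk (unitsMap t₀) y : higherUnits ϖ k) : Sˣ) : S) := by
    rw [coe_twistFun, map_add, map_one, map_mul, map_sub, map_one, hy]
    rfl
  have hunit : IsUnit (1 + ((t₀⁻¹ : Rˣ) : R) * ((r : R) - 1)) := by
    apply isUnit_of_map_unit (algebraMap R S)
    rw [hmap]
    exact Units.isUnit _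
  obtain ⟨r', hr'⟩ := hunit
  refine ⟨r', Units.ext ?_⟩
  rw [← hmap, ← hr']
  rfl

/-- `β_t` is trivial on the base units of `U_k` whenever `β` is and `t` is a base unit
(the prose «`β_t` is trivial on `U_E^k ∩ F_v^×`»). -/
theorem twist_eq_one_of_mem_range (hϖ : ϖ ∈ IsLocalRing.maximalIdeal S) (hk : 1 ≤ k)
    (β : higherUnits ϖ k →* ℂˣ)
    (hβ : ∀ y : higherUnits ϖ k, (y : Sˣ) ∈ higherUnits ϖ (2 * k) → β y = 1)
    (hβF : ∀ y : higherUnits ϖ k, (∃ r : Rˣ, (y : Sˣ) = unitsMap r) → β y = 1) (t₀ : Rˣ)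
    (y : higherUnits ϖ k) (hy : ∃ r : Rˣ, (y : Sˣ) = unitsMap r) :
    twist hϖ hk β hβ (unitsMap t₀) y = 1 := by
  obtain ⟨r, hr⟩ := hy
  exact hβF _ (exists_twistFun_eq_unitsMap hϖ hk t₀ y r hr)

end Base

section Package

variable {R S : Type*} [CommRing R] [CommRing S] [Algebra R S] [IsLocalRing S]
  [IsLocalHom (algebraMap R S)] {ϖ : S} {k : ℕ}

/-- THE N5.L6(2) PACKAGE at the level of `Sˣ`: a character `β` of `Sˣ` trivial on `U_{2k}` and
on the base units and non-trivial on `U_n` (`k ≤ n`) yields, for every base unit `t`, a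
character `β'` of `Sˣ` trivial on `U_{2k}` and on the base units, non-trivial on `U_n`, and
equal to `y ↦ β(1 + t⁻¹ (y − 1))` on `U_k` (the gluing lemma of
`T5RamifiedCharacterInflation` extends `β_t` from `U_k` to `Sˣ`). -/
theorem exists_twisted_character (hϖ : ϖ ∈ IsLocalRing.maximalIdeal S) (hk : 1 ≤ k)
    (β : Sˣ →* ℂˣ) (hβ : ∀ y ∈ higherUnits ϖ (2 * k), β y = 1)
    (hβF : ∀ r : Rˣ, β (unitsMap r) = 1) {n : ℕ} (hkn : k ≤ n)
    (hn : ∃ y ∈ higherUnits ϖ n, β y ≠ 1) (t₀ : Rˣ) :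
    ∃ β' : Sˣ →* ℂˣ, (∀ y ∈ higherUnits ϖ (2 * k), β' y = 1) ∧
      (∀ r : Rˣ, β' (unitsMap r) = 1) ∧ (∃ y ∈ higherUnits ϖ n, β' y ≠ 1) ∧
      ∀ (y : higherUnits ϖ k) (z : Sˣ),
        (z : S) = 1 + (((unitsMap t₀)⁻¹ : Sˣ) : S) * (((y : Sˣ) : S) - 1) → β' y = β z := by
  set β₀ : higherUnits ϖ k →* ℂˣ := β.comp (higherUnits ϖ k).subtype with hβ₀def
  have hβ₀ : ∀ y : higherUnits ϖ k, (y : Sˣ) ∈ higherUnits ϖ (2 * k) → β₀ y = 1 :=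
    fun y hy => hβ _ hy
  have hβ₀F : ∀ y : higherUnits ϖ k, (∃ r : Rˣ, (y : Sˣ) = unitsMap r) → β₀ y = 1 := by
    rintro y ⟨r, hr⟩
    show β (y : Sˣ) = 1
    rw [hr]
    exact hβF r
  obtain ⟨ψ, hψ1, hψ2⟩ := T5RamifiedCharacterInflation.exists_extension_of_eq_one_on_inf
    (higherUnits ϖ k) (unitsMap (R := R) (S := S)).range (twist hϖ hk β₀ hβ₀ (unitsMap t₀))
    (fun x hx => by
      obtain ⟨r, hr⟩ := MonoidHom.mem_range.1 hx
      exact twist_eq_one_of_mem_range hϖ hk β₀ hβ₀ hβ₀F t₀ x ⟨r, hr.symm⟩)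
  have hle : higherUnits ϖ (2 * k) ≤ higherUnits ϖ k := higherUnits_antitone ϖ (by omega)
  have hle' : higherUnits ϖ n ≤ higherUnits ϖ k := higherUnits_antitone ϖ hkn
  refine ⟨ψ, fun y hy => ?_, fun r => hψ2 _ (MonoidHom.mem_range.2 ⟨r, rfl⟩), ?_, ?_⟩
  · have h := hψ1 ⟨y, hle hy⟩
    rw [h]
    exact twist_eq_one_of_mem hϖ hk β₀ hβ₀ _ ⟨y, hle hy⟩ hy
  · obtain ⟨y, hy, hy'⟩ := hn
    obtain ⟨y', hy'mem, hy'ne⟩ := exists_twist_ne_one hϖ hk β₀ hβ₀ (unitsMap t₀) n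
      ⟨⟨y, hle' hy⟩, hy, hy'⟩
    refine ⟨y', hy'mem, ?_⟩
    rw [hψ1 y']
    exact hy'ne
  · intro y z hz
    rw [hψ1 y]
    show β ((twistFun hϖ hk (unitsMap t₀) y : Sˣ)) = β z
    congr 1
    apply Units.ext
    rw [coe_twistFun, hz]

/-- THE N5.L6(2) PACKAGE at the level of `Lˣ = Frac(S)ˣ` («`E_v^×`»): for `F ≤ Lˣ` with
`F ∩ image(Sˣ) ⊆ image(Rˣ)` («`F_v^× ∩ U_E = U_F`»), a character `β` of `Lˣ` trivial on `F` and
on `U_{2k}`, non-trivial on `U_n` (`k ≤ n`), and a base unit `t`, there is a character `β'` of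
`Lˣ` trivial on `F` and on `U_{2k}`, non-trivial on `U_n`, equal to `y ↦ β(1 + t⁻¹ (y − 1))` on
`U_k` — the prose's «`β_t` … extends to a conjugate-orthogonal character of `E_v^×` of conductor
exactly `2k`». -/
theorem exists_twisted_character_fractionRing {L : Type*} [Field L] [Algebra S L]
    [IsFractionRing S L] (hϖ : ϖ ∈ IsLocalRing.maximalIdeal S) (hk : 1 ≤ k) (F : Subgroup Lˣ)
    (hF : ∀ s : Sˣ, Units.map (algebraMap S L : S →* L) s ∈ F → ∃ r : Rˣ, s = unitsMap r)
    (β : Lˣ →* ℂˣ) (hβF : ∀ f ∈ F, β f = 1)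
    (hβ : ∀ y ∈ higherUnits ϖ (2 * k), β (Units.map (algebraMap S L : S →* L) y) = 1)
    (hβR : ∀ r : Rˣ, Units.map (algebraMap S L : S →* L) (unitsMap r) ∈ F) {n : ℕ} (hkn : k ≤ n)
    (hn : ∃ y ∈ higherUnits ϖ n, β (Units.map (algebraMap S L : S →* L) y) ≠ 1) (t₀ : Rˣ) :
    ∃ β' : Lˣ →* ℂˣ, (∀ f ∈ F, β' f = 1) ∧
      (∀ y ∈ higherUnits ϖ (2 * k), β' (Units.map (algebraMap S L : S →* L) y) = 1) ∧
      (∃ y ∈ higherUnits ϖ n, β' (Units.map (algebraMap S L : S →* L) y) ≠ 1) ∧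
      ∀ (y : higherUnits ϖ k) (z : Sˣ),
        (z : S) = 1 + (((unitsMap t₀)⁻¹ : Sˣ) : S) * (((y : Sˣ) : S) - 1) →
          β' (Units.map (algebraMap S L : S →* L) y) = β (Units.map (algebraMap S L : S →* L) z) := by
  obtain ⟨β₁, h1, h2, h3, h4⟩ := exists_twisted_character hϖ hk
    (β.comp (Units.map (algebraMap S L : S →* L))) hβ (fun r => hβF _ (hβR r)) hkn hn t₀
  obtain ⟨ψ, hψ1, hψ2⟩ := T5RamifiedCharacterInflation.exists_comp_eq_of_eq_one_on_preimage _
    (T5RamifiedCharacterInflation.unitsMapL_injective (S := S) (L := L)) F β₁ (fun s hs => by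
      obtain ⟨r, rfl⟩ := hF s hs
      exact h2 r)
  refine ⟨ψ, hψ2, fun y hy => by rw [hψ1]; exact h1 y hy, ?_, fun y z hz => by
    rw [hψ1]; exact h4 y z hz⟩
  obtain ⟨y, hy, hy'⟩ := h3
  exact ⟨y, hy, by rw [hψ1]; exact hy'⟩

end Package

end Summit.Ventures.HodgeRepro2.T5TwistedCharacter
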